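import Summits.QuantumFields.GaugeBoot.ZdReflectionGeometry
import Summits.QuantumFields.GaugeBoot.BootstrapLinkReversal
import Summits.QuantumFields.GaugeBoot.BootstrapSpaceGroupReductionZd
import HarnessLib

/-!
# The axis reflections of `ℤ^d` as link-reversing relabellings; the one-link Wilson boundary actions are reflection covariant (gauge-boot, L1/L4 supplement)

HONEST FRAMING (cell `pub-gaugeboot`, page 1 of every file): the venture produces certified bounds
on lattice expectations at stated coupling, gauge group, dimension and torus size; NOT a mass gap,
NOT a continuum limit, NOT a string tension; NOT Yang–Mills-summit-bearing (barriers
`FixedCouplingUltralocality`, `PerturbativeInvisibility`). Structural; it certifies no number.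

## Content

* `zdSiteReflectCM i = revRelabelCM (zdReflEdge i) (·.2 = i)` with ★ `zdSiteReflectCM_apply :
  zdSiteReflectCM i U = configSiteReflect i U` — the `ClassB` reflection of configurations IS a
  link-reversing relabelling (`BootstrapLinkReversal`), reversing the `i`-links; hence
  `comp_zdSiteReflectCM_mem_wordTruncation/_polyAlgebra` (words and polynomial observables are
  reflection stable), `zdSiteReflectCM_zdSiteReflectCM` (involution);
* ★ `zdSiteReflectCM_comp_edgeShift` (`Θ_i ∘ τ_v^* = τ_{θ_i v}^* ∘ Θ_i`: the reflections normalise the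
  translations), ★ `zdSiteReflectCM_comp_edgePerm` (`Θ_i ∘ π_σ^* = π_σ^* ∘ Θ_{σ i}`: axis permutations
  conjugate them), ★ `zdSiteReflectCM_comm` (they commute) — with the translations and the axis
  permutations they generate the full hyperoctahedral space group `B_d ⋉ ℤ^d`;
* ★★ `wilsonBoundaryAction_single_siteReflect` — the one-link Wilson boundary actions are reflection
  COVARIANT, `S_e (Θ_i U) = S_{θ_i e} U`: the hypothesis `hS` of `BootstrapLinkReversal` for `ℤ^d`.

References: K. Osterwalder, E. Seiler, Ann. Phys. 110 (1978) 440; V. Kazakov, Z. Zheng,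
arXiv:2203.11360 §3.3 (the lattice symmetry group `B_3` with reflections). Folklore.
-/

noncomputable section

open Literature.MathematicalPhysics.QuantumFieldTheory (LatticeRep)
open Literature.Probability.LatticeModels (Site)
open Literature.MathematicalPhysics.QuantumLattice

namespace Summit.QuantumFields.GaugeBoot

/-! ## The reflection of configurations as a link-reversing relabelling -/

section Config

variable {d : ℕ} {G : Type*} [Group G] [TopologicalSpace G] [IsTopologicalGroup G] (i : Fin d)

/-- **The axis reflection of configurations as a continuous self-map**: the link-reversing
relabelling by `zdReflEdge i`, reversing the `i`-links. [folklore] -/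
def zdSiteReflectCM : C(LGConfig d G, LGConfig d G) :=
  revRelabelCM (G := G) (zdReflEdge i) (fun e : ZdEdge d => e.2 = i)

/-- ★ **It is `configSiteReflect i`** of `ClassB`. -/
@[simp] theorem zdSiteReflectCM_apply (U : LGConfig d G) :
    zdSiteReflectCM (G := G) i U = configSiteReflect i U := by
  funext e
  change revRelabelCM (G := G) (zdReflEdge i) (fun e : ZdEdge d => e.2 = i) U e = _
  rw [revRelabelCM_apply]
  unfold configSiteReflect
  by_cases he : e.2 = i
  · rw [if_pos he, if_pos he, zdReflEdge_of_eq i he]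
  · rw [if_neg he, if_neg he, zdReflEdge_of_ne i he]

/-- As functions. -/
theorem coe_zdSiteReflectCM : ⇑(zdSiteReflectCM (G := G) i) = (configSiteReflect i : LGConfig d G → LGConfig d G) :=
  funext (zdSiteReflectCM_apply i)

/-- The reversed set is `θ_i`-stable (the axis is preserved). -/
theorem zdReflEdge_snd_eq_iff (e : ZdEdge d) : (zdReflEdge i e).2 = i ↔ e.2 = i := by
  rw [zdReflEdge_snd]

/-- `Θ_i` is an involution. -/
theorem zdSiteReflectCM_zdSiteReflectCM (U : LGConfig d G) :
    zdSiteReflectCM (G := G) i (zdSiteReflectCM (G := G) i U) = U :=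
  revRelabelCM_revRelabelCM _ _ (zdReflEdge_zdReflEdge i) (zdReflEdge_snd_eq_iff i) U

/-- An observable composed twice with `Θ_i` is itself. -/
theorem comp_zdSiteReflectCM_comp_zdSiteReflectCM (x : C(LGConfig d G, ℝ)) :
    (x.comp (zdSiteReflectCM (G := G) i)).comp (zdSiteReflectCM (G := G) i) = x :=
  comp_revRelabelCM_comp_revRelabelCM _ _ (zdReflEdge_zdReflEdge i) (zdReflEdge_snd_eq_iff i) x

/-- ★ **The reflection normalises the translations**: `Θ_i ∘ τ_v^* = τ_{θ_i v}^* ∘ Θ_i`. -/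
theorem zdSiteReflectCM_comp_edgeShift (v : Site d) :
    (zdSiteReflectCM (G := G) i).comp (relabelCM (edgeShift v)) =
      (relabelCM (G := G) (edgeShift (zdSiteReflect i v))).comp (zdSiteReflectCM (G := G) i) := by
  ext U e
  change revRelabelCM (G := G) (zdReflEdge i) (fun e : ZdEdge d => e.2 = i) (relabelCM (edgeShift v) U) e =
    revRelabelCM (G := G) (zdReflEdge i) (fun e : ZdEdge d => e.2 = i) U (edgeShift (zdSiteReflect i v) e)
  have h2 : (edgeShift (zdSiteReflect i v) e).2 = e.2 := rfl
  simp only [revRelabelCM_apply, relabelCM_apply, h2, zdReflEdge_edgeShift, zdSiteReflect_zdSiteReflect]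

/-- An observable translated then reflected is the reflected observable translated by `θ_i v`. -/
theorem comp_edgeShift_comp_zdSiteReflectCM (x : C(LGConfig d G, ℝ)) (v : Site d) :
    (x.comp (relabelCM (G := G) (edgeShift v))).comp (zdSiteReflectCM (G := G) i) =
      (x.comp (zdSiteReflectCM (G := G) i)).comp (relabelCM (G := G) (edgeShift (zdSiteReflect i v))) := by
  rw [ContinuousMap.comp_assoc, ContinuousMap.comp_assoc]
  congr 1
  have h := zdSiteReflectCM_comp_edgeShift (G := G) i (zdSiteReflect i v)
  rw [zdSiteReflect_zdSiteReflect] at h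
  exact h.symm

/-- ★ **Axis permutations conjugate the reflections**: `Θ_i ∘ π_σ^* = π_σ^* ∘ Θ_{σ i}`. -/
theorem zdSiteReflectCM_comp_edgePerm (σ : Equiv.Perm (Fin d)) :
    (zdSiteReflectCM (G := G) i).comp (relabelCM (edgePerm σ)) =
      (relabelCM (G := G) (edgePerm σ)).comp (zdSiteReflectCM (G := G) (σ i)) := by
  ext U e
  change revRelabelCM (G := G) (zdReflEdge i) (fun e : ZdEdge d => e.2 = i) (relabelCM (edgePerm σ) U) e =
    revRelabelCM (G := G) (zdReflEdge (σ i)) (fun e : ZdEdge d => e.2 = σ i) U (edgePerm σ e)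
  have h2 : ((edgePerm σ e).2 = σ i) = (e.2 = i) := by
    rw [Literature.MathematicalPhysics.QuantumLattice.edgePerm_apply]; exact propext σ.apply_eq_iff_eq
  simp only [revRelabelCM_apply, relabelCM_apply, zdReflEdge_edgePerm, Equiv.symm_apply_apply, h2]

/-- An observable permuted then reflected is the `σ⁻¹ i`-reflected observable permuted. -/
theorem comp_edgePerm_comp_zdSiteReflectCM (x : C(LGConfig d G, ℝ)) (σ : Equiv.Perm (Fin d)) :
    (x.comp (relabelCM (G := G) (edgePerm σ))).comp (zdSiteReflectCM (G := G) i) =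
      (x.comp (zdSiteReflectCM (G := G) (σ.symm i))).comp (relabelCM (G := G) (edgePerm σ)) := by
  rw [ContinuousMap.comp_assoc, ContinuousMap.comp_assoc]
  congr 1
  have h := zdSiteReflectCM_comp_edgePerm (G := G) (σ.symm i) σ
  rw [Equiv.apply_symm_apply] at h
  exact h.symm

/-- ★ **The reflections commute.** -/
theorem zdSiteReflectCM_comm (j : Fin d) :
    (zdSiteReflectCM (G := G) i).comp (zdSiteReflectCM (G := G) j) =
      (zdSiteReflectCM (G := G) j).comp (zdSiteReflectCM (G := G) i) := by
  by_cases hij : i = j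
  · rw [hij]
  ext U e
  change revRelabelCM (G := G) (zdReflEdge i) (fun e : ZdEdge d => e.2 = i)
      (revRelabelCM (G := G) (zdReflEdge j) (fun e : ZdEdge d => e.2 = j) U) e =
    revRelabelCM (G := G) (zdReflEdge j) (fun e : ZdEdge d => e.2 = j)
      (revRelabelCM (G := G) (zdReflEdge i) (fun e : ZdEdge d => e.2 = i) U) e
  simp only [revRelabelCM_apply, zdReflEdge_snd, zdReflEdge_comm i j e]
  by_cases hi : e.2 = i
  · simp only [hi, hij, ↓reduceIte]
  · by_cases hj : e.2 = j
    · have hji : ¬ j = i := fun h => hij h.symm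
      simp only [hj, hji, ↓reduceIte]
    · simp only [hi, hj, ↓reduceIte]

/-- An observable reflected in two axes in either order. -/
theorem comp_zdSiteReflectCM_comm (x : C(LGConfig d G, ℝ)) (j : Fin d) :
    (x.comp (zdSiteReflectCM (G := G) i)).comp (zdSiteReflectCM (G := G) j) =
      (x.comp (zdSiteReflectCM (G := G) j)).comp (zdSiteReflectCM (G := G) i) := by
  rw [ContinuousMap.comp_assoc, ContinuousMap.comp_assoc, zdSiteReflectCM_comm]

variable (r : LatticeRep G)

/-- The word truncation is reflection stable. -/
theorem comp_zdSiteReflectCM_mem_wordTruncation (n : ℕ) {x : C(LGConfig d G, ℝ)}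
    (hx : x ∈ wordTruncation (ι := ZdEdge d) r n) :
    x.comp (zdSiteReflectCM (G := G) i) ∈ wordTruncation (ι := ZdEdge d) r n :=
  comp_revRelabelCM_mem_wordTruncation r _ _ hx

/-- The polynomial observables are reflection stable. -/
theorem comp_zdSiteReflectCM_mem_polyAlgebra {x : C(LGConfig d G, ℝ)}
    (hx : x ∈ polyAlgebra (ι := ZdEdge d) r) :
    x.comp (zdSiteReflectCM (G := G) i) ∈ polyAlgebra (ι := ZdEdge d) r :=
  comp_revRelabelCM_mem_polyAlgebra r _ _ hx

end Config

/-! ## Covariance of the one-link Wilson boundary actions -/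

section Action

variable {d : ℕ} (i : Fin d) {G : Type*} [Group G] {N : ℕ} (ρ : G →* Matrix (Fin N) (Fin N) ℂ)
  [TopologicalSpace G] [IsTopologicalGroup G] [CompactSpace G]

/-- ★★ **The one-link Wilson boundary actions are reflection covariant**:
`S_e (Θ_i U) = S_{θ_i e} U` — the hypothesis `hS` of `BootstrapLinkReversal` for `ℤ^d`. -/
theorem wilsonBoundaryAction_single_siteReflect (hρ : Continuous ρ) (e : ZdEdge d) (U : LGConfig d G) :
    wilsonBoundaryAction ρ {e} (zdSiteReflectCM (G := G) i U) = wilsonBoundaryAction ρ {zdReflEdge i e} U := by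
  have hΛ : ({e} : Finset (ZdEdge d)) = ({zdReflEdge i e} : Finset (ZdEdge d)).map (zdReflEdgeEquiv i).toEmbedding := by
    rw [Finset.map_singleton, Equiv.toEmbedding_apply, zdReflEdgeEquiv_apply, zdReflEdge_zdReflEdge]
  rw [zdSiteReflectCM_apply, hΛ]
  exact wilsonBoundaryAction_map_zdReflEdge_siteReflect i ρ hρ {zdReflEdge i e} U

end Action

end Summit.QuantumFields.GaugeBoot

end
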